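import Summits.CriticalPhenomena.CardyFormulaZ2.Theses.CardyDualCurrent
import Summits.CriticalPhenomena.CardyFormulaZ2.Theorems.CardyComplexConeParafermionToSLESixFamiliesFaceKernelPercFaceK1
import Literature.Probability.Percolation.InterfaceScalingLimitDiscretised
import HarnessLib

/-!
# `MartingaleToSLE6` (stmt-CriticalPhenomena-11395): reduction to the two named percolation inputs of the q = 1 chain

Route `CardyDualCurrent` (sub-problem `CriticalPhenomena/CardyFormulaZ2`), crux r5
`Summit.CriticalPhenomena.CardyFormulaZ2.Theses.CardyDualCurrent.MartingaleToSLE6`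
(`TemplateCanonicalLimit → SLE6InterfaceLimit`), lead `prover-line-stmt-CriticalPhenomena-11395-0`,
line `registered` (birth skeleton, reshape r1 = `Cruxes/MartingaleToSLE6/Lines/birth.lean`).

Registered glue, sorry-free and BY NAME, recording where the crux stands in the tree:

* `sle6InterfaceLimit_iff_sle6LimitZ2AllDiscretisations` — the consequent is, by `Iff.rfl`, the
  Literature conjecture `SLE6LimitZ2AllDiscretisations` (refuter W.lean, 2026-08-15), hence block C
  of the sibling crux `CardyComplexCone.ParafermionToSLESixFamilies` (stmt-11389) bundled
  (`slesixAllFamilies_iff_sle6LimitZ2AllDiscretisations`).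
* `sle6InterfaceLimit_of_percKSBoxData_of_percParaClockData` — the CONSEQUENT of r5 follows from the
  two named percolation inputs of the landed q = 1 chain ALONE: Kemppainen–Smirnov lattice data
  `PercKSBoxData` and the clock-form slit-observable martingale approximation `PercParaClockData`
  (`slitMartingaleData_of_percClockData`, `slesixAllFamilies_of_slitMartingaleData`: tightness of
  families — Aizenman–Burchard, `ZdDiscretisationFamily.isTightAlongMesh_bondInterfaceIn` —,
  Kemppainen–Smirnov in approximating domains, the κ = 6 continuum step `stub_sleSixOfLimitData`,
  Prokhorov + uniqueness). In particular the antecedent `TemplateCanonicalLimit` is not needed once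
  `PercParaClockData` is known: any proof of the skeleton's stub
  `TemplateCanonicalLimit → PercParaClockData` makes r5 close, and so does `PercParaClockData` itself.
* `martingaleToSLE6_of_percKSBoxData` / `martingaleToSLE6_of_percFaceBoxTight` — r5 BY NAME from
  `PercKSBoxData` (resp. Kemppainen–Smirnov box tightness of the raw medial polyline,
  `PercFaceBoxTight`, through the landed `percKSBoxData_of_boxTight`, K1 proved) and the template
  clock data `TemplateCanonicalLimit → PercParaClockData` — the composition of skeleton r1.

Reading (lead's census, `Cruxes/MartingaleToSLE6/PROMOTE-stub_templateClockData.md`): the Doob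
martingale that the identification step must control is, for every conditioning step `n ≥ 1`, an
observable of PINNED data `(E, O, C)` (`percSlitExpectation_eq_integral_pin`, landed), which no
admissible `DiscreteDobrushin` datum renders (`not_isZdAdmissible_rendering_of_pin`, landed); the
antecedent `TemplateCanonicalLimit` speaks of the template observable of admissible data along
families of Jordan domains only, so it pins the normalisation at `n = 0` and is silent afterwards.
-/

namespace Summit.CriticalPhenomena.CardyFormulaZ2.Theorems

open Summit.CriticalPhenomena.CardyFormulaZ2.Cruxes.ParafermionToSLESixFamilies.CaratheodoryNetSlitUniformity
  (PercKSBoxData PercParaClockData PercFaceBoxTight SlitMartingaleData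
    slitMartingaleData_of_percClockData slesixAllFamilies_of_slitMartingaleData
    slesixAllFamilies_iff_sle6LimitZ2AllDiscretisations)
open Summit.CriticalPhenomena.CardyFormulaZ2.Cruxes.ParafermionToSLESixFamilies.FaceKernel
  (percKSBoxData_of_boxTight)
open Summit.CriticalPhenomena.CardyFormulaZ2.Theses.CardyDualCurrent
  (TemplateCanonicalLimit SLE6InterfaceLimit MartingaleToSLE6)

/-- The consequent `SLE6InterfaceLimit` of r5 is, by `Iff.rfl`, the Literature conjecture
`SLE6LimitZ2AllDiscretisations` (Smirnov ICM 2006 Conj. 4 at `q = 1`, all discretisations).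
[folklore] -/
theorem sle6InterfaceLimit_iff_sle6LimitZ2AllDiscretisations :
    SLE6InterfaceLimit ↔ Literature.Probability.Percolation.SLE6LimitZ2AllDiscretisations :=
  Iff.rfl

/-- **The consequent of r5 from the two named percolation inputs alone.** Kemppainen–Smirnov
lattice data for bond-ℤ² discretisation families (`PercKSBoxData`) and the clock-form
slit-observable martingale approximation (`PercParaClockData`) give SLE₆ convergence of the
interface along every discretisation family of every Dobrushin domain, through the landed chain
`slitMartingaleData_of_percClockData` ⟶ `slesixAllFamilies_of_slitMartingaleData`; no template
hypothesis enters. (Duminil-Copin–Smirnov 2012, §6; CDHKS 2014, §§2–3, at `q = 1`.) [folklore] -/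
theorem sle6InterfaceLimit_of_percKSBoxData_of_percParaClockData :
    PercKSBoxData → PercParaClockData → SLE6InterfaceLimit :=
  fun hKS hCl => sle6InterfaceLimit_iff_sle6LimitZ2AllDiscretisations.2
    (slesixAllFamilies_iff_sle6LimitZ2AllDiscretisations.1
      (slesixAllFamilies_of_slitMartingaleData (slitMartingaleData_of_percClockData hKS hCl)))

/-- **r5 `MartingaleToSLE6` BY NAME from `PercKSBoxData` and the template clock data** (the
composition of skeleton r1 of line `registered`): under the antecedent the second hypothesis
yields `PercParaClockData`, and `sle6InterfaceLimit_of_percKSBoxData_of_percParaClockData`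
concludes. [folklore] -/
theorem martingaleToSLE6_of_percKSBoxData :
    PercKSBoxData → (TemplateCanonicalLimit → PercParaClockData) → MartingaleToSLE6 :=
  fun hKS hCl hCanon => sle6InterfaceLimit_of_percKSBoxData_of_percParaClockData hKS (hCl hCanon)

/-- **r5 `MartingaleToSLE6` BY NAME from Kemppainen–Smirnov box tightness of the raw medial
polyline** (`PercFaceBoxTight`; the face-domain kernel input K1 is the landed theorem
`percFaceK1`, whence `percKSBoxData_of_boxTight`) and the template clock data. [folklore] -/
theorem martingaleToSLE6_of_percFaceBoxTight :
    PercFaceBoxTight → (TemplateCanonicalLimit → PercParaClockData) → MartingaleToSLE6 :=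
  fun hT hCl => martingaleToSLE6_of_percKSBoxData (percKSBoxData_of_boxTight hT) hCl

/-! ### Where r5 sits between its antecedent and its consequent (lead c1, 2026-08-17)

The three certificates below are pure logic on the route decls; they record in Lean the census
of line `registered` (`Cruxes/MartingaleToSLE6/PICKED.md`, `PROMOTE-stub_templateClockData.md`):
as filed, r5 `MartingaleToSLE6 := TemplateCanonicalLimit → SLE6InterfaceLimit` follows from its
consequent r6 by discarding the antecedent, and is EQUIVALENT to r6 as soon as the antecedent r9
holds — in particular in the route's own logic, where r2 `DualCurrentTemplateR` and r4
`CanonicalLimitFromExactCR` give r9 by modus ponens. So the crux carries independent content only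
through what a proof extracts from `TemplateCanonicalLimit`; the identification step extracts
nothing from it beyond the normalisation at conditioning step `n = 0` (pinned-data observables,
`percSlitExpectation_eq_integral_pin`, `not_isZdAdmissible_rendering_of_pin`). -/

open Summit.CriticalPhenomena.CardyFormulaZ2.Theses.CardyDualCurrent
  (DualCurrentTemplateR CanonicalLimitFromExactCR)

/-- **r5 from r6.** The crux `MartingaleToSLE6` is implied by its own consequent
`SLE6InterfaceLimit` (Smirnov ICM 2006 Conj. 4 at `q = 1`, all discretisations; item stmt-11283 of
this route, shared with `CardyViaSLE6` / `CardyRotToConf`): discard the antecedent. [folklore] -/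
theorem martingaleToSLE6_of_sle6InterfaceLimit : SLE6InterfaceLimit → MartingaleToSLE6 :=
  fun h6 _ => h6

/-- **Under its antecedent, r5 is r6.** If `TemplateCanonicalLimit` holds then
`MartingaleToSLE6 ↔ SLE6InterfaceLimit`. [folklore] -/
theorem martingaleToSLE6_iff_sle6InterfaceLimit_of_templateCanonicalLimit :
    TemplateCanonicalLimit → (MartingaleToSLE6 ↔ SLE6InterfaceLimit) :=
  fun h9 => ⟨fun h5 => h5 h9, fun h6 _ => h6⟩

/-- **In the route's own logic, r5 is r6.** Given the cruxes r2 `DualCurrentTemplateR` and r4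
`CanonicalLimitFromExactCR` (whose consequent is verbatim the body of `TemplateCanonicalLimit`),
`MartingaleToSLE6 ↔ SLE6InterfaceLimit`. [folklore] -/
theorem martingaleToSLE6_iff_sle6InterfaceLimit_of_cruxes :
    DualCurrentTemplateR → CanonicalLimitFromExactCR → (MartingaleToSLE6 ↔ SLE6InterfaceLimit) :=
  fun h2 h4 => martingaleToSLE6_iff_sle6InterfaceLimit_of_templateCanonicalLimit (h4 h2)

end Summit.CriticalPhenomena.CardyFormulaZ2.Theorems
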